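import Summits.QuantumFields.YangMills.Theorems.BalabanUVNodesN16AveragingTransferOfGaugeDefect
import Summits.QuantumFields.BalabanUV.T4Continuum.Spine.NE7.QLaTorusB7Averaging
import Summits.QuantumFields.BalabanUV.T4Continuum.Support.SubstrateVocabularyV3Descent
import HarnessLib

/-!
# YM-DAG node N16 (NE3), the located averaging pin (42) ↔ (0.4) — part 14: SCHEME-TO-SCHEME TRANSFER under block-lift covariance, and its first
# EXACT NON-ABELIAN instance — the CENTRE-CONVENTION (42) of the tree's torus instance (`QLaTorusB7Averaging.cstep`, Setup's `emb` base point) against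
# the corner-convention guarded (42): pointwise coarse-gauge equivalent at EVERY depth (frame transports), hence the same Theorem-1 leaves

Cell `pub-ymgap`, width seat `pub-ymgap-dag-n16-w3` (director-ym №197 ∕ HUMAN RULING D-0149), generation 6; part 14 of the W1b lineage (part 12 p612224: the transfer
under `ExactGaugeDefect`; part 13 p614236: same blocks, different base points).  `--supports stmt-QuantumFields-20544 --as helper` (K3⁷; count-neutral).  `bears_on: R4∕N16`.

THE POINT.  Part 12's criterion `ExactGaugeDefect` compares a scheme with (43) and asks covariance with the CORNER values `uLev L u k`.  The tree's torus instance of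
[Balaban1985Averaging] (42) in Setup's CENTRED convention (row NE7, `Spine/NE7/QLaTorusB7Averaging`: `cstep W z κ = frameTr W z · gb W (L•z) κ · (frameTr W (z+e_κ))⁻¹`,
`frameTr` = the in-block transport centre → corner, `gb` = the GUARDED (42)) is covariant with the CENTRE values (`cstep_gaugeAct`) — so part 12 does not apply
literally.  But part 12's proofs only ever gauge by BLOCK LIFTS `x ↦ κ(⌊x∕L^k⌋)`, which are CONSTANT on blocks: corner value = centre value = `κ`.  Hence:
 * §1 `SchemeGaugeEquiv d s₁ s₂ L N k C` — two depth-indexed schemes, (cov₁)(cov₂) covariance under BLOCK LIFTS of unitary `N`-periodic coarse gauges (the datum moving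
   by `κ` itself), (defect) pointwise coarse-gauge equivalence `avgIterS s₂ k U = (avgIterS s₁ k U)^{κ_U}` on `C`; ★★ `exists_isMinimiserS_gaugeAct_of_isMinimiserS` (both
   directions by symmetry of use): `s₂`-minimisers and `s₁`-minimisers at the SAME datum correspond under data-dependent block-lift gauges (part 12's abstract
   `minimiser_transfer`); ★ `leafH3supS_iff_of_schemeGaugeEquiv`; `ExactGaugeDefect.toSchemeGaugeEquiv` (part 12's criterion is the case `s₁ = step42`).
 * §2 `isPeriodic_of_isPeriodicCfg` (coordinate periods ⇒ lattice periods, `SubstrateVocabularyV3.apply_add_sum_period`), `floor_cen_iterate` (the `k`-fold centre map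
   `cen^k` stays in the block: `⌊cen^k(z)∕L^k⌋ = z`), `gaugeAct_gaugeAct` (composition of gauges).
 * §3 THE INSTANCE (every `P : Params`, `G = U(N)`, every depth `k`, every unit-torus side `T`): `iterate_gb_gaugeAct` ((45) for the iterated guarded corner step, corner
   values, EVERY unitary gauge — b07's `gb_gaugeAct` iterated), `iterate_cstep_gaugeAct` (centre values `u ∘ cen^k`), ★★ `iterate_cstep_eq_gaugeAct_iterate_gb` (for unitary
   `(T·L^k)`-periodic `W`: `cstep^k W = (gbstep^k W)^{κ}` with `κ` unitary `T`-periodic — the accumulated frame transports; EXACT, NON-ABELIAN, NO guard or smallness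
   hypothesis: both sides carry the same guard), ★★ `schemeGaugeEquiv_cstep` on `{unitary, (T·L^k)-periodic}`, ★ `leafH3supS_cstep_iff` (the Theorem-1 leaves of the
   centre-convention and of the corner-convention guarded (42) COINCIDE — DIVERGENCE F3 of `Setup` (corner vs centre labelling) is invisible to the constrained variational
   problem), and on the guard the corner-convention guarded step IS `step42` (`gbstep_eq_step42_of_guard`).

HONEST FRAMING.  [folklore] bookkeeping BY NAME over part 12 (`minimiser_transfer`, block lifts, `regularSup_of_regularSup_gaugeAct`), `QLaTorusB7Averaging` (`cstep`, `gb`,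
`frameTr`, `cstep_gaugeAct`, `gb_gaugeAct`, `cstep_mem`, `frameTr_mem`, `cstep_periodic`, `frameTr_periodic`, `cen_mem_block`), `SubstrateVocabularyV3Descent`,
`B7AvgGaugeCovariance.uLev`; ONE Prop-valued structure, 0 `sorry`, no `instance`, no `notation`; no minimiser constructed; nothing of [Balaban1985Averaging] ∕ [Balaban1987RG1]
asserted; the guarded step's identification with (43) beyond one guarded step (multi-level smallness) is NOT claimed; K3⁷ stubs NOT touched; N16 ∕ NE3 NOT discharged;
count-neutral (typed 28∕28 · discharged 5∕27 work-bound, A 5∕28 — unmoved).  One finite four-torus programme at fixed `ε` — the Yang–Mills mass gap (Clay) is NOT proved by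
any of this; R4 closes the conditional finite-𝕋⁴ rung `BalabanLadder.UV` only; nothing continuum ∕ ℝ⁴ ∕ OS.
-/

set_option autoImplicit false

open scoped BigOperators Matrix Matrix.Norms.L2Operator
open NormedSpace

namespace Summit.QuantumFields.YangMills.BalabanUVNodes.N16CentreConventionTransfer

open Literature.MathematicalPhysics.QuantumFieldTheory.Balaban1983to89
open B7Prop1Explicit B7Prop2Explicit
open B7AvgGaugeCovariance (uLev uLev_apply uLev_smul uLev_smul_add)
open T4TermwiseTorus (IsPeriodic)
open T4AveragingDeficitWall (IsUnitaryCfg)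
open T4AveragingDeficitWallBoundary (IsPeriodicCfg)
open Summit.QuantumFields.BalabanUV.T4Continuum
open MinimalActionLevels (levelAction)
open MinimalActionRate (sfClass)
open MinimalActionRefine (RegularSup)
open NE3EnergyShapes (IsUnitarySite IsPeriodicSite)
open NE3ResidualSliceRep (mem_sfClass_gaugeAct)
open AveragingDeficitKDatum (gaugeAct_inv_gaugeAct)
open NE7EtaMinimiserGaugeCovariance (levelAction_gaugeAct isUnitarySite_inv isPeriodicSite_inv)
open Summit.QuantumFields.YangMills.BalabanUVNodes.N16AveragingPin (avgIterS step42 avgIterS_step42 avgIterS_const IsMinimiserS LeafH3supS)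
open Summit.QuantumFields.YangMills.BalabanUVNodes.N16AveragingTransferOfGaugeDefect
  (minimiser_transfer uLev_blockLift isUnitarySite_blockLift isPeriodicSite_blockLift regularSup_of_regularSup_gaugeAct ExactGaugeDefect)
open Summit.QuantumFields.BalabanUV.T4Continuum.Spine.NE7.TorusB7
  (Guard gb frameTr cstep cen hb hb_le cstep_gaugeAct gb_gaugeAct frameTr_gaugeAct cstep_mem frameTr_mem cstep_periodic frameTr_periodic)
open Summit.QuantumFields.BalabanUV.T4Continuum.SubstrateVocabularyV3 (apply_add_sum_period)

noncomputable section

/-! ## §1 Scheme-to-scheme transfer under block-lift covariance -/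

section Schemes

variable {d : ℕ} {n : Type*} [Fintype n] [DecidableEq n]

variable (d) in
/-- **POINTWISE COARSE-GAUGE EQUIVALENCE OF TWO SCHEMES, with covariance asked only under BLOCK LIFTS.**  For depth-indexed schemes `s₁, s₂` (g0's `avgIterS`), depth `k`,
block side `L`, unit-torus side `N` and a class `C`: (cov₁)∕(cov₂) for every unitary `N`-periodic coarse gauge `κ`, gauging `U ∈ C` by the block lift `x ↦ κ(⌊x∕L^k⌋)`
moves each scheme's `k`-fold average by `κ` ITSELF (true for corner-covariant schemes, `uLev` of a block lift is `κ`, AND for centre-covariant ones, the lift being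
constant on blocks); (defect) every `U ∈ C` has a unitary `N`-periodic `κ_U` with `avgIterS s₂ k U = (avgIterS s₁ k U)^{κ_U}`.  A hypothesis SHAPE; inhabited
non-trivially in §3. [folklore] -/
@[folklore]
structure SchemeGaugeEquiv (s₁ s₂ : ℕ → (Site d → Fin d → (Matrix n n ℂ)ˣ) → (Site d → Fin d → (Matrix n n ℂ)ˣ)) (L N k : ℕ)
    (C : Set (Site d → Fin d → (Matrix n n ℂ)ˣ)) : Prop where
  /-- (cov₁) block lifts move `s₁`'s `k`-fold average by `κ` -/
  cov₁ : ∀ (κ : Site d → (Matrix n n ℂ)ˣ) (U : Site d → Fin d → (Matrix n n ℂ)ˣ), IsUnitarySite κ → IsPeriodicSite κ (N : ℤ) → U ∈ C →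
    avgIterS s₁ k (gaugeAct (fun x : Site d => κ (fun i => x i / (L : ℤ) ^ k)) U) = gaugeAct κ (avgIterS s₁ k U)
  /-- (cov₂) block lifts move `s₂`'s `k`-fold average by `κ` -/
  cov₂ : ∀ (κ : Site d → (Matrix n n ℂ)ˣ) (U : Site d → Fin d → (Matrix n n ℂ)ˣ), IsUnitarySite κ → IsPeriodicSite κ (N : ℤ) → U ∈ C →
    avgIterS s₂ k (gaugeAct (fun x : Site d => κ (fun i => x i / (L : ℤ) ^ k)) U) = gaugeAct κ (avgIterS s₂ k U)
  /-- (defect) on `C` the two `k`-fold averages are pointwise coarse-gauge equivalent -/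
  defect : ∀ U ∈ C, ∃ κ : Site d → (Matrix n n ℂ)ˣ, IsUnitarySite κ ∧ IsPeriodicSite κ (N : ℤ) ∧
    avgIterS s₂ k U = gaugeAct κ (avgIterS s₁ k U)

/-- The equivalence restricts to sub-classes. [folklore] -/
theorem SchemeGaugeEquiv.of_subset {s₁ s₂ : ℕ → (Site d → Fin d → (Matrix n n ℂ)ˣ) → (Site d → Fin d → (Matrix n n ℂ)ˣ)} {L N k : ℕ}
    {C C' : Set (Site d → Fin d → (Matrix n n ℂ)ˣ)} (h : SchemeGaugeEquiv d s₁ s₂ L N k C) (hC' : C' ⊆ C) : SchemeGaugeEquiv d s₁ s₂ L N k C' where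
  cov₁ κ U hκ hκP hU := h.cov₁ κ U hκ hκP (hC' hU)
  cov₂ κ U hκ hκP hU := h.cov₂ κ U hκ hκP (hC' hU)
  defect U hU := h.defect U (hC' hU)

/-- **PART 12's CRITERION IS THE CASE `s₁ = step42`**: `ExactGaugeDefect d s L N k C` gives `SchemeGaugeEquiv d (step42) s L N k C` ((45) for (43) is unconditional,
`B7Prop6Flat.avgIter_gaugeAct_units`; the corner values of a block lift are `κ`, part 12 `uLev_blockLift`). [folklore] -/
theorem ExactGaugeDefect.toSchemeGaugeEquiv {s : ℕ → (Site d → Fin d → (Matrix n n ℂ)ˣ) → (Site d → Fin d → (Matrix n n ℂ)ˣ)} {L N k : ℕ}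
    (hL : 1 ≤ L) {C : Set (Site d → Fin d → (Matrix n n ℂ)ˣ)} (h : ExactGaugeDefect d s L N k C) :
    SchemeGaugeEquiv d (fun _ => step42 L) s L N k C where
  cov₁ κ U _ _ _ := by
    rw [avgIterS_step42, avgIterS_step42, B7Prop6Flat.avgIter_gaugeAct_units, uLev_blockLift L hL k κ]
  cov₂ κ U hκ hκP hU := by
    rw [h.cov _ U (isUnitarySite_blockLift hκ _) (isPeriodicSite_blockLift L hL k hκP) hU, uLev_blockLift L hL k κ]
  defect U hU := by
    obtain ⟨κ, hκ, hκP, hdef⟩ := h.defect U hU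
    exact ⟨κ, hκ, hκP, by rw [avgIterS_step42, hdef]⟩

variable {s₁ s₂ : ℕ → (Site d → Fin d → (Matrix n n ℂ)ˣ) → (Site d → Fin d → (Matrix n n ℂ)ˣ)}
  {𝒞 : ℕ → Set (Site d → Fin d → (Matrix n n ℂ)ˣ)} {L N k : ℕ}

/-- **★★ SCHEME-TO-SCHEME TRANSFER OF CONSTRAINED MINIMISERS AT THE SAME DATUM.**  On a class `𝒞 k` invariant under unitary `(N·L^k)`-periodic gauges, if `s₁, s₂` are
pointwise coarse-gauge equivalent with block-lift covariance, every `s₂`-constrained minimiser `U` at datum `V` is carried by the block lift of `κ_U` (unitary,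
`(N·L^k)`-periodic) to an `s₁`-constrained minimiser at the SAME datum: part 12's `minimiser_transfer` with `Φ U = U^{lift κ_U}`, `Ψ U = U^{lift κ_U⁻¹}`. [folklore] -/
theorem exists_isMinimiserS_gaugeAct_of_isMinimiserS (hL : 1 ≤ L)
    (hC : ∀ (u : Site d → (Matrix n n ℂ)ˣ) (U : Site d → Fin d → (Matrix n n ℂ)ˣ), IsUnitarySite u →
      IsPeriodicSite u ((N * L ^ k : ℕ) : ℤ) → U ∈ 𝒞 k → gaugeAct u U ∈ 𝒞 k)
    (hE : SchemeGaugeEquiv d s₁ s₂ L N k (𝒞 k)) {V U : Site d → Fin d → (Matrix n n ℂ)ˣ} (hU : IsMinimiserS d s₂ 𝒞 L N k V U) :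
    ∃ u : Site d → (Matrix n n ℂ)ˣ, IsUnitarySite u ∧ IsPeriodicSite u ((N * L ^ k : ℕ) : ℤ) ∧
      IsMinimiserS d s₁ 𝒞 L N k V (gaugeAct u U) := by
  classical
  choose! κ hκu hκP hκdef using hE.defect
  set lift : (Site d → Fin d → (Matrix n n ℂ)ˣ) → Site d → (Matrix n n ℂ)ˣ :=
    fun U x => κ U (fun i => x i / (L : ℤ) ^ k) with hlift
  set liftInv : (Site d → Fin d → (Matrix n n ℂ)ˣ) → Site d → (Matrix n n ℂ)ˣ :=
    fun U x => (κ U (fun i => x i / (L : ℤ) ^ k))⁻¹ with hliftInv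
  have hlu : ∀ U ∈ 𝒞 k, IsUnitarySite (lift U) := fun U hU => isUnitarySite_blockLift (hκu U hU) _
  have hlP : ∀ U ∈ 𝒞 k, IsPeriodicSite (lift U) ((N * L ^ k : ℕ) : ℤ) := fun U hU =>
    isPeriodicSite_blockLift L hL k (hκP U hU)
  have hliu : ∀ U ∈ 𝒞 k, IsUnitarySite (liftInv U) := fun U hU => isUnitarySite_inv (hlu U hU)
  have hliP : ∀ U ∈ 𝒞 k, IsPeriodicSite (liftInv U) ((N * L ^ k : ℕ) : ℤ) := fun U hU => isPeriodicSite_inv (hlP U hU)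
  have hκiu : ∀ U ∈ 𝒞 k, IsUnitarySite (fun w => (κ U w)⁻¹) := fun U hU => isUnitarySite_inv (hκu U hU)
  have hκiP : ∀ U ∈ 𝒞 k, IsPeriodicSite (fun w => (κ U w)⁻¹) (N : ℤ) := fun U hU => isPeriodicSite_inv (hκP U hU)
  obtain ⟨hUC, hUV⟩ := hU.mem
  have main := minimiser_transfer (avgIterS s₁ k) (avgIterS s₂ k) (𝒞 k) (levelAction d L N k)
    (fun W => gaugeAct (lift W) W) (fun W => gaugeAct (liftInv W) W)
    (fun W hW => hC _ _ (hlu W hW) (hlP W hW) hW) (fun W hW => hC _ _ (hliu W hW) (hliP W hW) hW)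
    (fun W _ => levelAction_gaugeAct L N k _ W) (fun W _ => levelAction_gaugeAct L N k _ W)
    (fun W hW => by
      show avgIterS s₁ k (gaugeAct (lift W) W) = avgIterS s₂ k W
      rw [hE.cov₁ _ W (hκu W hW) (hκP W hW) hW, hκdef W hW])
    (fun W hW => by
      show avgIterS s₂ k (gaugeAct (liftInv W) W) = avgIterS s₁ k W
      rw [hE.cov₂ (fun w => (κ W w)⁻¹) W (hκiu W hW) (hκiP W hW) hW, hκdef W hW, gaugeAct_inv_gaugeAct])
    hUC hUV (fun U' hU'C hU'V => hU.le U' ⟨hU'C, hU'V⟩)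
  obtain ⟨h1, h2, h3⟩ := main
  exact ⟨lift U, hlu U hUC, hlP U hUC, ⟨h1, h2⟩, fun U' hU' => h3 U' hU'.1 hU'.2⟩

/-- The equivalence is symmetric in use: swapping the roles of `s₁, s₂` (the inverse gauge `κ_U⁻¹`). [folklore] -/
theorem SchemeGaugeEquiv.symm {C : Set (Site d → Fin d → (Matrix n n ℂ)ˣ)} (h : SchemeGaugeEquiv d s₁ s₂ L N k C) :
    SchemeGaugeEquiv d s₂ s₁ L N k C where
  cov₁ := h.cov₂
  cov₂ := h.cov₁
  defect U hU := by
    obtain ⟨κ, hκ, hκP, hdef⟩ := h.defect U hU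
    refine ⟨fun w => (κ w)⁻¹, isUnitarySite_inv hκ, isPeriodicSite_inv hκP, ?_⟩
    rw [hdef, gaugeAct_inv_gaugeAct]

variable [Nonempty n] {ε b c : ℝ} {dom : Set (Site d → Fin d → (Matrix n n ℂ)ˣ)}

/-- **★ THE THEOREM-1 LEAVES OF TWO EQUIVALENT SCHEMES COINCIDE**: if `s₁, s₂` are pointwise coarse-gauge equivalent (block-lift covariance) at every depth `k+1` on
`sfClass d L N ε (k+1)`, then g0's `LeafH3supS d s₁` and `LeafH3supS d s₂` are EQUIVALENT (minimisers correspond, `RegularSup` is gauge invariant — part 12 §3). [folklore] -/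
theorem leafH3supS_iff_of_schemeGaugeEquiv (hL : 1 ≤ L) (hE : ∀ k : ℕ, SchemeGaugeEquiv d s₁ s₂ L N (k + 1) (sfClass d L N ε (k + 1))) :
    LeafH3supS d s₂ L N ε b c dom ↔ LeafH3supS d s₁ L N ε b c dom := by
  constructor
  · intro h V hV k U hU
    obtain ⟨u, hu, huP, hmin⟩ := exists_isMinimiserS_gaugeAct_of_isMinimiserS (𝒞 := sfClass d L N ε) hL
      (fun u U hu huP hU => mem_sfClass_gaugeAct hu huP hU) (hE k).symm hU
    exact regularSup_of_regularSup_gaugeAct hu huP (h V hV k _ hmin)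
  · intro h V hV k U hU
    obtain ⟨u, hu, huP, hmin⟩ := exists_isMinimiserS_gaugeAct_of_isMinimiserS (𝒞 := sfClass d L N ε) hL
      (fun u U hu huP hU => mem_sfClass_gaugeAct hu huP hU) (hE k) hU
    exact regularSup_of_regularSup_gaugeAct hu huP (h V hV k _ hmin)

end Schemes

/-! ## §2 Lattice bookkeeping: periods, the iterated centre map, composition of gauges -/

section Lattice

variable {d : ℕ} {n : Type*} [Fintype n] [DecidableEq n]

/-- A lattice-period vector is the sum of its coordinate periods: `T•m = Σ_κ (m_κ T) e_κ`. [folklore] -/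
theorem natCast_smul_eq_sum_e (T : ℕ) (m : Site d) : (T : ℤ) • m = ∑ κ : Fin d, (m κ * (T : ℤ)) • e κ := by
  funext i
  rw [Pi.smul_apply, smul_eq_mul, Finset.sum_apply]
  simp only [Pi.smul_apply, smul_eq_mul, e, Pi.single_apply, mul_ite, mul_one, mul_zero, Finset.sum_ite_eq, Finset.mem_univ, if_true]
  ring

/-- **COORDINATE PERIODS ⇒ LATTICE PERIODS**: the tree's `IsPeriodicCfg U T` (shifts by `T e_κ`) gives lit-balaban's `T4TermwiseTorus.IsPeriodic T U` (shifts by `T•m`,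
all `m ∈ ℤᵈ`) — `SubstrateVocabularyV3.apply_add_sum_period`. [folklore] -/
theorem isPeriodic_of_isPeriodicCfg {P : Params} {T : ℕ} {U : Site P.d → Fin P.d → (Matrix n n ℂ)ˣ} (hU : IsPeriodicCfg U (T : ℤ)) :
    IsPeriodic T U := by
  intro x m
  funext μ
  rw [natCast_smul_eq_sum_e, apply_add_sum_period hU]

/-- Composition of gauge transformations: `(V^{b})^{a} = V^{a·b}` (pointwise product). [folklore] -/
theorem gaugeAct_gaugeAct {G : Type*} [Group G] (a b : Site d → G) (V : Site d → Fin d → G) :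
    gaugeAct a (gaugeAct b V) = gaugeAct (fun z => a z * b z) V := by
  funext z μ
  simp only [gaugeAct, mul_inv_rev, mul_assoc]

/-- The `k`-fold centre map stays in the `L^k`-block: `cen^k(z) = L^k•z + t` with `0 ≤ t_i < L^k`. [folklore] -/
theorem cen_iterate_eq (P : Params) : ∀ (k : ℕ) (z : Site P.d), ∃ t : Site P.d, (∀ i, 0 ≤ t i ∧ t i < (P.L : ℤ) ^ k) ∧
    (cen P)^[k] z = ((P.L : ℤ) ^ k) • z + t
  | 0, z => ⟨0, fun _ => ⟨le_rfl, by simp⟩, by simp⟩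
  | k + 1, z => by
    obtain ⟨t, ht, hk⟩ := cen_iterate_eq P k z
    refine ⟨fun i => (P.L : ℤ) * t i + (hb P : ℤ), fun i => ⟨?_, ?_⟩, ?_⟩
    · have := (ht i).1; positivity
    · have h1 := (ht i).2
      have hL := hb_le P
      have hL0 : (0 : ℤ) ≤ (P.L : ℤ) := by positivity
      have : (P.L : ℤ) * t i ≤ (P.L : ℤ) * ((P.L : ℤ) ^ k - 1) := mul_le_mul_of_nonneg_left (by omega) hL0
      rw [pow_succ]
      nlinarith
    · rw [Function.iterate_succ_apply', hk]
      funext i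
      simp only [cen, Pi.add_apply, Pi.smul_apply, smul_eq_mul, pow_succ]
      ring

/-- Hence `⌊cen^k(z)_i ∕ L^k⌋ = z_i`: a block lift at scale `L^k` takes the value `κ z` at the `k`-fold centre. [folklore] -/
theorem floor_cen_iterate (P : Params) (k : ℕ) (z : Site P.d) (i : Fin P.d) : ((cen P)^[k] z) i / (P.L : ℤ) ^ k = z i := by
  obtain ⟨t, ht, hk⟩ := cen_iterate_eq P k z
  have hLk : (0 : ℤ) < (P.L : ℤ) ^ k := pow_pos (by have := P.hL.2; positivity) _
  rw [hk, Pi.add_apply, Pi.smul_apply, smul_eq_mul, add_comm, Int.add_mul_ediv_left _ _ hLk.ne',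
    Int.ediv_eq_zero_of_lt (ht i).1 (ht i).2, zero_add]

/-- A block lift at scale `L^k`, read at the `k`-fold centre, returns `κ`. [folklore] -/
theorem blockLift_cen_iterate {G : Type*} (P : Params) (k : ℕ) (κ : Site P.d → G) (z : Site P.d) :
    (fun x : Site P.d => κ (fun i => x i / (P.L : ℤ) ^ k)) ((cen P)^[k] z) = κ z := by
  simp only [floor_cen_iterate]

end Lattice

/-! ## §3 The instance: centre-convention (42) against the corner-convention guarded (42), at every depth -/

section Instance

variable (P : Params) (N : ℕ) [NeZero N]

open Summit.QuantumFields.BalabanUV.T4Continuum.Spine.NE7.TorusB7 (Mat)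

omit [NeZero N] in
/-- On the guard the corner-convention guarded step IS `step42` at that bond: `gb W q κ = bavg L W q κ`. [folklore] -/
theorem gb_eq_bavg_of_guard {W : Site P.d → Fin P.d → (Mat N)ˣ} {q : Site P.d} {κ : Fin P.d} (h : Guard P N W q κ) :
    gb P N W q κ = bavg P.L W q κ := by
  classical
  unfold gb
  rw [if_pos h]

omit [NeZero N] in
/-- The centre-convention step is the corner-convention guarded step RE-GAUGED by the frame transports: `cstep W = (rescale L (gb W))^{frameTr W}`. [folklore] -/
theorem cstep_eq_gaugeAct_gbstep (W : Site P.d → Fin P.d → (Mat N)ˣ) :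
    cstep P N W = gaugeAct (frameTr P N W) (rescale P.L (gb P N W)) := by
  funext z κ
  simp only [cstep, gaugeAct, rescale_apply]

/-- **(45) FOR THE ITERATED GUARDED CORNER STEP, EVERY UNITARY GAUGE**: `gbstep^k (W^u) = (gbstep^k W)^{uLev L u k}` (b07's `gb_gaugeAct` iterated; no smallness). [folklore] -/
theorem iterate_gb_gaugeAct {u : Site P.d → (Mat N)ˣ} (hu : ∀ x, u x ∈ unitaryUnits (Mat N)) :
    ∀ (k : ℕ) (W : Site P.d → Fin P.d → (Mat N)ˣ),
      (fun W => rescale P.L (gb P N W))^[k] (gaugeAct u W) = gaugeAct (uLev P.L u k) ((fun W => rescale P.L (gb P N W))^[k] W)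
  | 0, W => by simp
  | k + 1, W => by
    rw [Function.iterate_succ_apply', Function.iterate_succ_apply', iterate_gb_gaugeAct hu k W]
    funext z κ
    have huk : ∀ x, uLev P.L u k x ∈ unitaryUnits (Mat N) := fun x => hu _
    rw [rescale_apply, gb_gaugeAct huk]
    simp only [gaugeAct, rescale_apply, uLev_smul, uLev_smul_add]

/-- **(45) FOR THE ITERATED CENTRE STEP**: `cstep^k (W^u) = (cstep^k W)^{u ∘ cen^k}` (`cstep_gaugeAct` iterated: centre values). [folklore] -/
theorem iterate_cstep_gaugeAct :
    ∀ (k : ℕ) {u : Site P.d → (Mat N)ˣ} (_hu : ∀ x, u x ∈ unitaryUnits (Mat N)) (W : Site P.d → Fin P.d → (Mat N)ˣ),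
      (cstep P N)^[k] (gaugeAct u W) = gaugeAct (fun z => u ((cen P)^[k] z)) ((cstep P N)^[k] W)
  | 0, u, _, W => by simp
  | k + 1, u, hu, W => by
    have h1 : cstep P N (gaugeAct u W) = gaugeAct (fun z => u (cen P z)) (cstep P N W) := by
      funext z κ; rw [cstep_gaugeAct hu]; rfl
    rw [Function.iterate_succ_apply, Function.iterate_succ_apply, h1,
      iterate_cstep_gaugeAct k (u := fun z => u (cen P z)) (fun x => hu _) (cstep P N W)]
    congr 1
    funext z
    rw [← Function.iterate_succ_apply' (cen P) k z, Function.iterate_succ_apply]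

/-- **★★ THE CENTRE-CONVENTION ITERATE IS A DATA-DEPENDENT COARSE GAUGE TRANSFORM OF THE CORNER-CONVENTION ITERATE — EXACT, NON-ABELIAN, NO SMALLNESS.**
For every unitary `(T·L^k)`-periodic `W`: `cstep^k W = (gbstep^k W)^{κ}` for some unitary `T`-periodic `κ` (the accumulated frame transports
`frameTr` of the intermediate averages, pushed through (45)). [folklore] -/
theorem iterate_cstep_eq_gaugeAct_iterate_gb (T : ℕ) :
    ∀ (k : ℕ) (W : Site P.d → Fin P.d → (Mat N)ˣ), (∀ x κ, W x κ ∈ unitaryUnits (Mat N)) → IsPeriodic (T * P.L ^ k) W →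
      ∃ κ : Site P.d → (Mat N)ˣ, IsUnitarySite κ ∧ IsPeriodicSite κ (T : ℤ) ∧
        (cstep P N)^[k] W = gaugeAct κ ((fun W => rescale P.L (gb P N W))^[k] W)
  | 0, W, _, _ => ⟨fun _ => 1, fun _ => (unitaryUnits (Mat N)).one_mem, fun _ _ => rfl, by
      funext z μ; simp [gaugeAct]⟩
  | k + 1, W, hW, hWP => by
    -- the first step, then the induction hypothesis on `cstep W`
    have hW1 : ∀ x κ, cstep P N W x κ ∈ unitaryUnits (Mat N) := fun x κ => cstep_mem hW x κ
    have hWP' : IsPeriodic (T * P.L ^ k * P.L) W := by rwa [pow_succ, ← mul_assoc] at hWP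
    have hWP1 : IsPeriodic (T * P.L ^ k) (cstep P N W) := cstep_periodic hWP'
    obtain ⟨κ', hκ'u, hκ'P, hk⟩ := iterate_cstep_eq_gaugeAct_iterate_gb T k (cstep P N W) hW1 hWP1
    have hfr : ∀ x, frameTr P N W x ∈ unitaryUnits (Mat N) := fun x => frameTr_mem hW x
    have hfrP : IsPeriodic (T * P.L ^ k) (frameTr P N W) := frameTr_periodic hWP'
    refine ⟨fun w => κ' w * uLev P.L (frameTr P N W) k w, fun w => (unitaryUnits (Mat N)).mul_mem (hκ'u w) (hfr _),
      fun w i => ?_, ?_⟩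
    · -- periodicity of the accumulated gauge
      show κ' (w + (T : ℤ) • e i) * uLev P.L (frameTr P N W) k (w + (T : ℤ) • e i) = κ' w * uLev P.L (frameTr P N W) k w
      have h2 : uLev P.L (frameTr P N W) k (w + (T : ℤ) • e i) = uLev P.L (frameTr P N W) k w := by
        simp only [uLev_apply, smul_add, smul_smul]
        rw [show ((P.L : ℤ) ^ k * (T : ℤ)) • e i = ((T * P.L ^ k : ℕ) : ℤ) • e i by push_cast; rw [mul_comm]]
        exact hfrP _ _
      rw [hκ'P w i, h2]
    · rw [Function.iterate_succ_apply, hk, Function.iterate_succ_apply, cstep_eq_gaugeAct_gbstep,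
        iterate_gb_gaugeAct P N hfr k, gaugeAct_gaugeAct]

variable {P N}

/-- **★★ THE INSTANCE**: at every depth `k`, on the class of unitary `(T·L^k)`-periodic configurations, the centre-convention (42) `cstep` and the
corner-convention guarded (42) `W ↦ rescale L (gb W)` are POINTWISE COARSE-GAUGE EQUIVALENT with block-lift covariance (`SchemeGaugeEquiv`) — no smallness, no guard
hypothesis (both schemes carry the same guard). [folklore] -/
theorem schemeGaugeEquiv_cstep (k T : ℕ) :
    SchemeGaugeEquiv P.d (fun _ => fun W => rescale P.L (gb P N W)) (fun _ => cstep P N) P.L T k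
      {U | (∀ x κ, U x κ ∈ unitaryUnits (Mat N)) ∧ IsPeriodicCfg U ((T * P.L ^ k : ℕ) : ℤ)} where
  cov₁ κ U hκ _ _ := by
    have hlu : ∀ x, (fun x : Site P.d => κ (fun i => x i / (P.L : ℤ) ^ k)) x ∈ unitaryUnits (Mat N) := fun x => hκ _
    rw [avgIterS_const, avgIterS_const, iterate_gb_gaugeAct P N hlu k U, uLev_blockLift P.L P.hL.2.le k κ]
  cov₂ κ U hκ _ _ := by
    have hlu : ∀ x, (fun x : Site P.d => κ (fun i => x i / (P.L : ℤ) ^ k)) x ∈ unitaryUnits (Mat N) := fun x => hκ _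
    rw [avgIterS_const, avgIterS_const, iterate_cstep_gaugeAct P N k hlu U]
    congr 1
    funext z
    exact blockLift_cen_iterate P k κ z
  defect U hU := by
    obtain ⟨κ, hκ, hκP, h⟩ := iterate_cstep_eq_gaugeAct_iterate_gb P N T k U hU.1 (isPeriodic_of_isPeriodicCfg hU.2)
    exact ⟨κ, hκ, hκP, by rw [avgIterS_const, avgIterS_const, h]⟩

/-- **★ HENCE THE THEOREM-1 LEAVES OF THE TWO CONVENTIONS COINCIDE**: for every radius `ε`, letters `b, c` and data `dom`, g0's `LeafH3supS` for the centre-convention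
(42) `cstep` (the tree's torus instance, Setup's `emb` base point, row NE7) and for the corner-convention guarded (42) are EQUIVALENT — Setup's DIVERGENCE F3 (corner
vs centre labelling of the coarse sites) is invisible to the constrained variational problem.  (The small-field classes are unitary and periodic, so §3 applies at
every depth.) [folklore] -/
theorem leafH3supS_cstep_iff (T : ℕ) (ε b c : ℝ) (dom : Set (Site P.d → Fin P.d → (Mat N)ˣ)) :
    LeafH3supS P.d (fun _ => cstep P N) P.L T ε b c dom ↔ LeafH3supS P.d (fun _ => fun W => rescale P.L (gb P N W)) P.L T ε b c dom :=
  leafH3supS_iff_of_schemeGaugeEquiv P.hL.2.le fun k =>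
    (schemeGaugeEquiv_cstep (P := P) (N := N) (k + 1) T).of_subset fun _ hU => ⟨hU.1, hU.2.1⟩

omit [NeZero N] in
/-- And the corner-convention guarded step agrees with `step42` wherever the guard holds at every bond (one step; the tree's (42) itself). [folklore] -/
theorem gbstep_eq_step42_of_guard {W : Site P.d → Fin P.d → (Mat N)ˣ} (h : ∀ q κ, Guard P N W q κ) :
    rescale P.L (gb P N W) = step42 P.L W := by
  funext z κ
  rw [rescale_apply, gb_eq_bavg_of_guard P N (h _ _)]
  rfl

end Instance

end

end Summit.QuantumFields.YangMills.BalabanUVNodes.N16CentreConventionTransfer
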